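import Summits.AnomalousDissipation.AnomalousDissipation.Theorems.SawtoothPulseCascadeK1LocalisedCascadeGeomStripStepsCTE
import Summits.AnomalousDissipation.AnomalousDissipation.Theorems.SawtoothPulseCascadeK1LocalisedCascadeCTScalars

/-!
# K1loc — THE FOUR PHASE-3 WINDOWS IN CORNER-TRACE GRADE WITH AGGREGATE TRACKED ENERGY ON RATIO-9/8 BLOCKS (numeric frame)

Prover lane on the crux `K1LocalisedCascade` (stmt-AnomalousDissipation-19491), route `SawtoothPulseCascade` (S-D seat; arbiter
A24-6: «Geom CTE at ρ = 9/8 → phase files → PhaseStep3CTE symbolic», finding F-p1g8-1).  The four half-step windows of one phase of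
the fibre ledger — (T-H) low fibres `T_j(K′)` from the strip `S_j(K)` and the off-cone class `O_j(K) = Σ'[K ≤ |k₀| ∧ |k₀| ≤ 4|k₁|]`,
(S-V) the next strip `S_{j+1}(K″)` from `T_j(K′)` and the sub-cone feed `C_j(Y) = Σ'[Y ≤ |k₀| ∧ |k₁| ≤ 3|k₀|]‖𝓕b_j‖²`, (O-V) the next
off-cone class `O_{j+1}(K″)` from `C_j(Y)`, (C-H) `C_j(Y)` from the shell `A_j(Y) = Σ'[Y ≤ |k₀| ∧ |k₀| ≤ 2|k₁|]‖𝓕a_j‖²` — at the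
cascade shape `γ = 8, d = 2, N₀ = 1, ρ_N = 2` (`N_j = 2^j`), over `…Geom{Ratio,Strip}StepsCTE` with the block ratio `9/8`, zone
parameter `M = 10`, rounding `ε = 2⁻⁷⁰ ≥ e^{−50}` (`…CTScalars.exp_neg_sq_half_ten_le`), and the thresholds `K, K′, K″, Y` and the
number of blocks `M_b` SYMBOLIC (design of record, HOME/ad-sawtooth-k1loc-p1/e3_design-g8.py: `K′ ≈ 4K`, `Y ≈ (9/8)K′/3`; the
V-type feeds carry their threshold on the source index, so `Y ≤ K′/3 + 1` and `Y ≤ (K″/4)/3 + 1` are required).  Lobe and cut-off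
fractions: T-H `q = 27/64`, `c = 11/16` (feed slope `1/4`, trace ratio `27/5`); S-V and O-V `q = 27/64`, `c = 9/10` (feed slope
`1/3`, trace ratio `19`); C-H `q = 45/64`, `c = 13/16` (feed slope `1/2`, trace ratio `29/3`).  Each window is stated in the shape
`x ≤ base + ((w + √feed)² + tail²)` / `x ≤ (w + √feed)² + tail²` consumed by `…LedgerFeedChain.strip_offCone_resolved_step`, with
`w = √(A + β*/2) + √(ρ*/2 + Z)` explicit.  The only hypotheses left are linear threshold inequalities and `10·δ_j < π/2`.
No definitions; no statement about the crux. [cite: Grafakos2014, Prop. 3.1.2 (5), Prop. 3.2.7 (3), §3.1.3] [problem: turb]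
-/

-- `Summit.<Summit>.<Problem>`: single-conjunct summit, the duplicate namespace segment is deliberate.
set_option linter.dupNamespace false

noncomputable section

namespace Summit.AnomalousDissipation.AnomalousDissipation.Theorems.SawtoothPulseCascade.K1Window

open MeasureTheory Set Filter Topology UnitAddTorus Function Complex Metric
open scoped Real ENNReal
open Literature.Analysis Literature.Analysis.FunctionSpaces Literature.Analysis.FunctionSpaces.Torus Literature.Analysis.FluidPDE
open Literature.Analysis.FluidPDE.ShearStage
open Literature.Analysis.FluidPDE.SawtoothCascade Literature.Analysis.FluidPDE.SawtoothCascade.CascadeParams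
open Summit.AnomalousDissipation.AnomalousDissipation.Theorems.SawtoothPulseCascade.K1Start
open Summit.AnomalousDissipation.AnomalousDissipation.Theorems.SawtoothPulseCascade.K1Flat
open Summit.AnomalousDissipation.AnomalousDissipation.Theorems.SawtoothPulseCascade.K1Ledger.From

section Cascade

variable (P : CascadeParams)

/-- **(T-H) IN CTE-GEOM GRADE** (see the file header): for `K ≥ 107` and `64K′ < 485(K−1)`,
`T_j(K′) ≤ S_j(K) + ((w_T + √O_j(K))² + ((1+γ)^{2j}/Λ_{M_b})²)`. [cite: Grafakos2014, Prop. 3.1.2 (5), Prop. 3.2.7 (3), §3.1.3] -/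
theorem lowFibre_hstep_cte_le (hγ : P.γ = 8) (hδ₀ : 0 < P.δ₀) (hd : P.d = 2) (hN₀ : P.N₀ = 1) (hρN : P.ρN = 2)
    (a b : ℕ → UnitAddTorus (Fin 2) → ℝ) (has : ∀ j, IsSmooth (a j)) (h0 : a 0 = datum)
    (hb : ∀ j, b j = a j ∘ shearMap 0 1 (amp ⟨P.U j, P.U_periodic j, P.contDiff_U (P.δ_pos hδ₀ (by rw [hd]; norm_num) j)⟩ P.γ))
    (hab : ∀ j, a (j + 1) = b j ∘ shearMap 1 0 (amp ⟨P.U j, P.U_periodic j, P.contDiff_U (P.δ_pos hδ₀ (by rw [hd]; norm_num) j)⟩ P.γ))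
    (j : ℕ) {K K' : ℕ} (hK : 107 ≤ K) (hK' : 64 * K' < 485 * (K - 1)) (Mb : ℕ)
    (hMδ : 10 * P.δ j < π / 2) :
    ∑' k : Fin 2 → ℤ, (if |k 1| < (K' : ℤ) then (1 : ℝ) else 0) * ‖mFourierCoeff (fun x => (b j x : ℂ)) k‖ ^ 2 ≤
      ∑' k : Fin 2 → ℤ, (if |k 0| < (K : ℤ) then (1 : ℝ) else 0) * ‖mFourierCoeff (fun x => (a j x : ℂ)) k‖ ^ 2 +
      ((Real.sqrt (6 * (P.N j : ℝ) ^ 2 * (((((16 : ℕ)) : ℝ) + ((11 : ℕ))) / ((((16 : ℕ)) : ℝ) - ((11 : ℕ)))) *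
              (((((9 : ℕ)) : ℝ) / ((8 : ℕ))) ^ 2 / ((((((9 : ℕ)) : ℝ) / ((8 : ℕ))) ^ 2 - 1) * ((((8 : ℕ) : ℝ)) * ((K : ℝ) - 1) - K') ^ 2) +
                ((((9 : ℕ)) : ℝ) / ((8 : ℕ))) / ((((((9 : ℕ)) : ℝ) / ((8 : ℕ))) - 1) * (P.N j * ((((8 : ℕ) : ℝ)) * ((K : ℝ) - 1) - K')))) / π ^ 2 +
            12 * (P.N j : ℝ) ^ 2 * ((((27 : ℕ) : ℝ)) * K / ((((((8 : ℕ) : ℝ)) * ((64 : ℕ)) - ((27 : ℕ))) * ((K : ℝ) - 1) - K' * ((64 : ℕ))))) ^ 2 *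
              (2 * ((((27 : ℕ) : ℝ)) * K / ((64 : ℕ))) / (P.N j * ((((8 : ℕ) : ℝ)) * ((K : ℝ) - 1) - K') ^ 2) + 2 * ((((27 : ℕ) : ℝ)) * K / ((64 : ℕ))) / ((P.N j : ℝ) ^ 2 * ((((8 : ℕ) : ℝ)) * ((K : ℝ) - 1) - K')) +
                1 / ((((8 : ℕ) : ℝ)) * ((K : ℝ) - 1) - K') ^ 2 + 1 / (P.N j * ((((8 : ℕ) : ℝ)) * ((K : ℝ) - 1) - K'))) / π ^ 2 / 2) +
          Real.sqrt ((π * ((K : ℝ) * ((8 : ℕ))) * ((((9 : ℕ)) : ℝ) / ((8 : ℕ))) ^ Mb * ((2 : ℝ)⁻¹ ^ 70) / P.N j) ^ 2 / 2 +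
            Mb * (8 * (10 : ℝ) * P.δ j / π * (((((16 : ℕ)) : ℝ) + ((11 : ℕ))) / ((((16 : ℕ)) : ℝ) - ((11 : ℕ)))))) +
          Real.sqrt (∑' k : Fin 2 → ℤ, (if (K : ℤ) ≤ |k 0| ∧ (((1 : ℕ)) : ℤ) * |k 0| ≤ (((4 : ℕ)) : ℤ) * |k 1| then (1 : ℝ) else 0) *
            ‖mFourierCoeff (fun x => (a j x : ℂ)) k‖ ^ 2)) ^ 2 +
        ((1 + P.γ) ^ (2 * j) / ((K * 9 ^ Mb / 8 ^ Mb : ℕ) : ℝ)) ^ 2) := by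
  have hγ' : P.γ = ((8 : ℕ) : ℝ) := by rw [hγ]; norm_num
  have hd' : 0 < P.d := by rw [hd]; norm_num
  have hN₀' : 1 ≤ P.N₀ := by rw [hN₀]
  have hρN' : 1 ≤ P.ρN := by rw [hρN]; norm_num
  have hε : Real.exp (-((10 : ℝ) ^ 2 / 2)) ≤ (2 : ℝ)⁻¹ ^ 70 := exp_neg_sq_half_ten_le
  have hM : (1 : ℝ) ≤ 10 := by norm_num
  have hKq : K' * 64 + 27 * (K - 1) < 8 * 64 * (K - 1) := by omega
  exact lowFibre_hstep_geomCTE_le P hγ' hδ₀ hd' hN₀' hρN' a b has h0 hb hab j (K := K') (u' := 1) (v' := 4) (qn := 27)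
    (qd := 64) (cn := 11) (cd := 16) (ra := 9) (rb := 8) (Λ0 := K) (by norm_num) hKq (by norm_num) (by norm_num) (by omega)
    (by norm_num) (by norm_num) (by omega) (by norm_num) (by norm_num) (by omega) Mb hM hMδ hε

/-- **(S-V) IN CTE-GEOM GRADE** (see the file header): for `K′ ≥ 264`, `64K″ < 485(K′−1)` and a feed threshold `Y ≤ K′/3 + 1`,
`S_{j+1}(K″) ≤ T_j(K′) + ((w_S + √C_j(Y))² + ((1+γ)^{2(j+1)}/Λ_{M_b})²)`. [cite: Grafakos2014, Prop. 3.1.2 (5), Prop. 3.2.7 (3), §3.1.3] -/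
theorem strip_vstep_cte_le (hγ : P.γ = 8) (hδ₀ : 0 < P.δ₀) (hd : P.d = 2) (hN₀ : P.N₀ = 1) (hρN : P.ρN = 2)
    (a b : ℕ → UnitAddTorus (Fin 2) → ℝ) (has : ∀ j, IsSmooth (a j)) (h0 : a 0 = datum)
    (hb : ∀ j, b j = a j ∘ shearMap 0 1 (amp ⟨P.U j, P.U_periodic j, P.contDiff_U (P.δ_pos hδ₀ (by rw [hd]; norm_num) j)⟩ P.γ))
    (hab : ∀ j, a (j + 1) = b j ∘ shearMap 1 0 (amp ⟨P.U j, P.U_periodic j, P.contDiff_U (P.δ_pos hδ₀ (by rw [hd]; norm_num) j)⟩ P.γ))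
    (j : ℕ) {K' K'' Y : ℕ} (hK' : 264 ≤ K') (hK'' : 64 * K'' < 485 * (K' - 1))
    (hY : Y ≤ K' / 3 + 1) (Mb : ℕ) (hMδ : 10 * P.δ j < π / 2) :
    ∑' k : Fin 2 → ℤ, (if |k 0| < (K'' : ℤ) then (1 : ℝ) else 0) * ‖mFourierCoeff (fun x => (a (j + 1) x : ℂ)) k‖ ^ 2 ≤
      ∑' k : Fin 2 → ℤ, (if |k 1| < (K' : ℤ) then (1 : ℝ) else 0) * ‖mFourierCoeff (fun x => (b j x : ℂ)) k‖ ^ 2 +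
      ((Real.sqrt (6 * (P.N j : ℝ) ^ 2 * (((((10 : ℕ)) : ℝ) + ((9 : ℕ))) / ((((10 : ℕ)) : ℝ) - ((9 : ℕ)))) *
              (((((9 : ℕ)) : ℝ) / ((8 : ℕ))) ^ 2 / ((((((9 : ℕ)) : ℝ) / ((8 : ℕ))) ^ 2 - 1) * ((((8 : ℕ) : ℝ)) * ((K' : ℝ) - 1) - K'') ^ 2) +
                ((((9 : ℕ)) : ℝ) / ((8 : ℕ))) / ((((((9 : ℕ)) : ℝ) / ((8 : ℕ))) - 1) * (P.N j * ((((8 : ℕ) : ℝ)) * ((K' : ℝ) - 1) - K'')))) / π ^ 2 +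
            12 * (P.N j : ℝ) ^ 2 * ((((27 : ℕ) : ℝ)) * K' / ((((((8 : ℕ) : ℝ)) * ((64 : ℕ)) - ((27 : ℕ))) * ((K' : ℝ) - 1) - K'' * ((64 : ℕ))))) ^ 2 *
              (2 * ((((27 : ℕ) : ℝ)) * K' / ((64 : ℕ))) / (P.N j * ((((8 : ℕ) : ℝ)) * ((K' : ℝ) - 1) - K'') ^ 2) + 2 * ((((27 : ℕ) : ℝ)) * K' / ((64 : ℕ))) / ((P.N j : ℝ) ^ 2 * ((((8 : ℕ) : ℝ)) * ((K' : ℝ) - 1) - K'')) +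
                1 / ((((8 : ℕ) : ℝ)) * ((K' : ℝ) - 1) - K'') ^ 2 + 1 / (P.N j * ((((8 : ℕ) : ℝ)) * ((K' : ℝ) - 1) - K''))) / π ^ 2 / 2) +
          Real.sqrt ((π * ((K' : ℝ) * ((8 : ℕ))) * ((((9 : ℕ)) : ℝ) / ((8 : ℕ))) ^ Mb * ((2 : ℝ)⁻¹ ^ 70) / P.N j) ^ 2 / 2 +
            Mb * (8 * (10 : ℝ) * P.δ j / π * (((((10 : ℕ)) : ℝ) + ((9 : ℕ))) / ((((10 : ℕ)) : ℝ) - ((9 : ℕ)))))) +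
          Real.sqrt (∑' k : Fin 2 → ℤ, (if (Y : ℤ) ≤ |k 0| ∧ (((1 : ℕ)) : ℤ) * |k 1| ≤ (((3 : ℕ)) : ℤ) * |k 0| then (1 : ℝ) else 0) *
            ‖mFourierCoeff (fun x => (b j x : ℂ)) k‖ ^ 2)) ^ 2 +
        ((1 + P.γ) ^ (2 * (j + 1)) / ((K' * 9 ^ Mb / 8 ^ Mb : ℕ) : ℝ)) ^ 2) := by
  have hγ' : P.γ = ((8 : ℕ) : ℝ) := by rw [hγ]; norm_num
  have hd' : 0 < P.d := by rw [hd]; norm_num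
  have hN₀' : 1 ≤ P.N₀ := by rw [hN₀]
  have hρN' : 1 ≤ P.ρN := by rw [hρN]; norm_num
  have hε : Real.exp (-((10 : ℝ) ^ 2 / 2)) ≤ (2 : ℝ)⁻¹ ^ 70 := exp_neg_sq_half_ten_le
  have hM : (1 : ℝ) ≤ 10 := by norm_num
  have hKq : K'' * 64 + 27 * (K' - 1) < 8 * 64 * (K' - 1) := by omega
  have hY' : Y ≤ 1 * K' / 3 + 1 := by simpa using hY
  exact strip_vstep_geomCTE_le P hγ' hδ₀ hd' hN₀' hρN' a b has h0 hb hab j (K := K'') (u' := 1) (v' := 3) (Y := Y) (qn := 27)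
    (qd := 64) (cn := 9) (cd := 10) (ra := 9) (rb := 8) (Λ0 := K') (by norm_num) hKq (by norm_num) (by norm_num) (by omega)
    (by norm_num) (by norm_num) (by omega) (by norm_num) (by norm_num) (by omega) hY' Mb hM hMδ hε

/-- **(O-V) IN CTE-GEOM GRADE** (see the file header): for `K″ ≥ 1060` and a feed threshold `Y ≤ (K″/4)/3 + 1`,
`O_{j+1}(K″) ≤ (w_O + √C_j(Y))² + ((1+γ)^{2(j+1)}/Λ_{M_b})²` (fibre floor `⌊K″/4⌋`). [cite: Grafakos2014, Prop. 3.1.2 (5), Prop. 3.2.7 (3), §3.1.3] -/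
theorem offCone_vstep_cte_le (hγ : P.γ = 8) (hδ₀ : 0 < P.δ₀) (hd : P.d = 2) (hN₀ : P.N₀ = 1) (hρN : P.ρN = 2)
    (a b : ℕ → UnitAddTorus (Fin 2) → ℝ) (has : ∀ j, IsSmooth (a j)) (h0 : a 0 = datum)
    (hb : ∀ j, b j = a j ∘ shearMap 0 1 (amp ⟨P.U j, P.U_periodic j, P.contDiff_U (P.δ_pos hδ₀ (by rw [hd]; norm_num) j)⟩ P.γ))
    (hab : ∀ j, a (j + 1) = b j ∘ shearMap 1 0 (amp ⟨P.U j, P.U_periodic j, P.contDiff_U (P.δ_pos hδ₀ (by rw [hd]; norm_num) j)⟩ P.γ))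
    (j : ℕ) {K'' Y : ℕ} (hK'' : 1060 ≤ K'') (hY : Y ≤ K'' / 4 / 3 + 1) (Mb : ℕ)
    (hMδ : 10 * P.δ j < π / 2) :
    ∑' k : Fin 2 → ℤ, (if (K'' : ℤ) ≤ |k 0| ∧ (((1 : ℕ)) : ℤ) * |k 0| ≤ (((4 : ℕ)) : ℤ) * |k 1| then (1 : ℝ) else 0) *
        ‖mFourierCoeff (fun x => (a (j + 1) x : ℂ)) k‖ ^ 2 ≤
      (Real.sqrt (6 * (P.N j : ℝ) ^ 2 * (((((10 : ℕ)) : ℝ) + ((9 : ℕ))) / ((((10 : ℕ)) : ℝ) - ((9 : ℕ)))) *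
              (((((9 : ℕ)) : ℝ) / ((8 : ℕ))) ^ 2 / ((((((9 : ℕ)) : ℝ) / ((8 : ℕ))) ^ 2 - 1) * (((((1 : ℕ)) : ℝ) * ((8 : ℕ)) - ((4 : ℕ))) * ((((K'' / 4 : ℕ) : ℝ)) - 1) / ((1 : ℕ))) ^ 2) +
                ((((9 : ℕ)) : ℝ) / ((8 : ℕ))) / ((((((9 : ℕ)) : ℝ) / ((8 : ℕ))) - 1) * (P.N j * (((((1 : ℕ)) : ℝ) * ((8 : ℕ)) - ((4 : ℕ))) * ((((K'' / 4 : ℕ) : ℝ)) - 1) / ((1 : ℕ)))))) / π ^ 2 +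
            12 * (P.N j : ℝ) ^ 2 * ((((1 : ℕ)) : ℝ) * ((27 : ℕ)) * (K'' / 4 : ℕ) / ((((((1 : ℕ)) : ℝ) * ((8 : ℕ)) - ((4 : ℕ))) * ((64 : ℕ)) - ((1 : ℕ)) * ((27 : ℕ))) * ((((K'' / 4 : ℕ) : ℝ)) - 1))) ^ 2 *
              (2 * ((((27 : ℕ) : ℝ)) * (K'' / 4 : ℕ) / ((64 : ℕ))) / (P.N j * (((((1 : ℕ)) : ℝ) * ((8 : ℕ)) - ((4 : ℕ))) * ((((K'' / 4 : ℕ) : ℝ)) - 1) / ((1 : ℕ))) ^ 2) + 2 * ((((27 : ℕ) : ℝ)) * (K'' / 4 : ℕ) / ((64 : ℕ))) / ((P.N j : ℝ) ^ 2 * (((((1 : ℕ)) : ℝ) * ((8 : ℕ)) - ((4 : ℕ))) * ((((K'' / 4 : ℕ) : ℝ)) - 1) / ((1 : ℕ)))) +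
                1 / (((((1 : ℕ)) : ℝ) * ((8 : ℕ)) - ((4 : ℕ))) * ((((K'' / 4 : ℕ) : ℝ)) - 1) / ((1 : ℕ))) ^ 2 + 1 / (P.N j * (((((1 : ℕ)) : ℝ) * ((8 : ℕ)) - ((4 : ℕ))) * ((((K'' / 4 : ℕ) : ℝ)) - 1) / ((1 : ℕ))))) / π ^ 2 / 2) +
          Real.sqrt ((π * ((((K'' / 4 : ℕ) : ℝ)) * ((8 : ℕ))) * ((((9 : ℕ)) : ℝ) / ((8 : ℕ))) ^ Mb * ((2 : ℝ)⁻¹ ^ 70) / P.N j) ^ 2 / 2 +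
            Mb * (8 * (10 : ℝ) * P.δ j / π * (((((10 : ℕ)) : ℝ) + ((9 : ℕ))) / ((((10 : ℕ)) : ℝ) - ((9 : ℕ)))))) +
          Real.sqrt (∑' k : Fin 2 → ℤ, (if (Y : ℤ) ≤ |k 0| ∧ (((1 : ℕ)) : ℤ) * |k 1| ≤ (((3 : ℕ)) : ℤ) * |k 0| then (1 : ℝ) else 0) *
            ‖mFourierCoeff (fun x => (b j x : ℂ)) k‖ ^ 2)) ^ 2 +
        ((1 + P.γ) ^ (2 * (j + 1)) / (((K'' / 4 : ℕ) * 9 ^ Mb / 8 ^ Mb : ℕ) : ℝ)) ^ 2 := by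
  have hγ' : P.γ = ((8 : ℕ) : ℝ) := by rw [hγ]; norm_num
  have hd' : 0 < P.d := by rw [hd]; norm_num
  have hN₀' : 1 ≤ P.N₀ := by rw [hN₀]
  have hρN' : 1 ≤ P.ρN := by rw [hρN]; norm_num
  have hε : Real.exp (-((10 : ℝ) ^ 2 / 2)) ≤ (2 : ℝ)⁻¹ ^ 70 := exp_neg_sq_half_ten_le
  have hM : (1 : ℝ) ≤ 10 := by norm_num
  have hΛ0 : 2 ≤ K'' / 4 := by omega
  have hΛX : 4 * (K'' / 4) ≤ 1 * K'' := by omega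
  have hY' : Y ≤ 1 * (K'' / 4) / 3 + 1 := by simpa using hY
  have h264 : 264 ≤ K'' / 4 := by omega
  exact ratioClass_vstep_geomCTE_le P hγ' hδ₀ hd' hN₀' hρN' a b has h0 hb hab j (u := 1) (v := 4) (X := K'') (u' := 1) (v' := 3)
    (Y := Y) (qn := 27) (qd := 64) (cn := 9) (cd := 10) (ra := 9) (rb := 8) (Λ0 := K'' / 4) (by norm_num) (by norm_num)
    (by norm_num) (by norm_num) (by norm_num) (by norm_num) (by norm_num) hΛ0 hΛX (by norm_num) (by norm_num) (by omega)
    (by norm_num) (by norm_num) (by omega) hY' Mb hM hMδ hε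

/-- **(C-H) IN CTE-GEOM GRADE** (see the file header): for `Y ≥ 150`,
`C_j(Y) ≤ (w_C + √A_j(Y))² + ((1+γ)^{2j}/Λ_{M_b})²`. [cite: Grafakos2014, Prop. 3.1.2 (5), Prop. 3.2.7 (3), §3.1.3] -/
theorem subcone_hstep_cte_le (hγ : P.γ = 8) (hδ₀ : 0 < P.δ₀) (hd : P.d = 2) (hN₀ : P.N₀ = 1) (hρN : P.ρN = 2)
    (a b : ℕ → UnitAddTorus (Fin 2) → ℝ) (has : ∀ j, IsSmooth (a j)) (h0 : a 0 = datum)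
    (hb : ∀ j, b j = a j ∘ shearMap 0 1 (amp ⟨P.U j, P.U_periodic j, P.contDiff_U (P.δ_pos hδ₀ (by rw [hd]; norm_num) j)⟩ P.γ))
    (hab : ∀ j, a (j + 1) = b j ∘ shearMap 1 0 (amp ⟨P.U j, P.U_periodic j, P.contDiff_U (P.δ_pos hδ₀ (by rw [hd]; norm_num) j)⟩ P.γ))
    (j : ℕ) {Y : ℕ} (hY : 150 ≤ Y) (Mb : ℕ) (hMδ : 10 * P.δ j < π / 2) :
    ∑' k : Fin 2 → ℤ, (if (Y : ℤ) ≤ |k 0| ∧ (((1 : ℕ)) : ℤ) * |k 1| ≤ (((3 : ℕ)) : ℤ) * |k 0| then (1 : ℝ) else 0) *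
        ‖mFourierCoeff (fun x => (b j x : ℂ)) k‖ ^ 2 ≤
      (Real.sqrt (6 * (P.N j : ℝ) ^ 2 * (((((16 : ℕ)) : ℝ) + ((13 : ℕ))) / ((((16 : ℕ)) : ℝ) - ((13 : ℕ)))) *
              (((((9 : ℕ)) : ℝ) / ((8 : ℕ))) ^ 2 / ((((((9 : ℕ)) : ℝ) / ((8 : ℕ))) ^ 2 - 1) * (((((1 : ℕ)) : ℝ) * ((8 : ℕ)) - ((3 : ℕ))) * ((Y : ℝ) - 1) / ((1 : ℕ))) ^ 2) +
                ((((9 : ℕ)) : ℝ) / ((8 : ℕ))) / ((((((9 : ℕ)) : ℝ) / ((8 : ℕ))) - 1) * (P.N j * (((((1 : ℕ)) : ℝ) * ((8 : ℕ)) - ((3 : ℕ))) * ((Y : ℝ) - 1) / ((1 : ℕ)))))) / π ^ 2 +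
            12 * (P.N j : ℝ) ^ 2 * ((((1 : ℕ)) : ℝ) * ((45 : ℕ)) * Y / ((((((1 : ℕ)) : ℝ) * ((8 : ℕ)) - ((3 : ℕ))) * ((64 : ℕ)) - ((1 : ℕ)) * ((45 : ℕ))) * ((Y : ℝ) - 1))) ^ 2 *
              (2 * ((((45 : ℕ) : ℝ)) * Y / ((64 : ℕ))) / (P.N j * (((((1 : ℕ)) : ℝ) * ((8 : ℕ)) - ((3 : ℕ))) * ((Y : ℝ) - 1) / ((1 : ℕ))) ^ 2) + 2 * ((((45 : ℕ) : ℝ)) * Y / ((64 : ℕ))) / ((P.N j : ℝ) ^ 2 * (((((1 : ℕ)) : ℝ) * ((8 : ℕ)) - ((3 : ℕ))) * ((Y : ℝ) - 1) / ((1 : ℕ)))) +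
                1 / (((((1 : ℕ)) : ℝ) * ((8 : ℕ)) - ((3 : ℕ))) * ((Y : ℝ) - 1) / ((1 : ℕ))) ^ 2 + 1 / (P.N j * (((((1 : ℕ)) : ℝ) * ((8 : ℕ)) - ((3 : ℕ))) * ((Y : ℝ) - 1) / ((1 : ℕ))))) / π ^ 2 / 2) +
          Real.sqrt ((π * ((Y : ℝ) * ((8 : ℕ))) * ((((9 : ℕ)) : ℝ) / ((8 : ℕ))) ^ Mb * ((2 : ℝ)⁻¹ ^ 70) / P.N j) ^ 2 / 2 +
            Mb * (8 * (10 : ℝ) * P.δ j / π * (((((16 : ℕ)) : ℝ) + ((13 : ℕ))) / ((((16 : ℕ)) : ℝ) - ((13 : ℕ)))))) +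
          Real.sqrt (∑' k : Fin 2 → ℤ, (if (Y : ℤ) ≤ |k 0| ∧ (((1 : ℕ)) : ℤ) * |k 0| ≤ (((2 : ℕ)) : ℤ) * |k 1| then (1 : ℝ) else 0) *
            ‖mFourierCoeff (fun x => (a j x : ℂ)) k‖ ^ 2)) ^ 2 +
        ((1 + P.γ) ^ (2 * j) / ((Y * 9 ^ Mb / 8 ^ Mb : ℕ) : ℝ)) ^ 2 := by
  have hγ' : P.γ = ((8 : ℕ) : ℝ) := by rw [hγ]; norm_num
  have hd' : 0 < P.d := by rw [hd]; norm_num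
  have hN₀' : 1 ≤ P.N₀ := by rw [hN₀]
  have hρN' : 1 ≤ P.ρN := by rw [hρN]; norm_num
  have hε : Real.exp (-((10 : ℝ) ^ 2 / 2)) ≤ (2 : ℝ)⁻¹ ^ 70 := exp_neg_sq_half_ten_le
  have hM : (1 : ℝ) ≤ 10 := by norm_num
  exact ratioClass_hstep_geomCTE_le P hγ' hδ₀ hd' hN₀' hρN' a b has h0 hb hab j (u := 1) (v := 3) (u' := 1) (v' := 2)
    (Y := Y) (qn := 45) (qd := 64) (cn := 13) (cd := 16) (ra := 9) (rb := 8) (Λ0 := Y) (by norm_num) (by norm_num)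
    (by norm_num) (by norm_num) (by norm_num) (by norm_num) (by norm_num) (by omega) le_rfl (by norm_num) (by norm_num) (by omega)
    (by norm_num) (by norm_num) (by omega) Mb hM hMδ hε

end Cascade

end Summit.AnomalousDissipation.AnomalousDissipation.Theorems.SawtoothPulseCascade.K1Window
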